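import Literature.Computability.Complexity.SpaceLoop
import Literature.Computability.Complexity.SpaceLoopBounded
import Literature.Computability.Complexity.TM2Iterate
import Literature.Computability.Complexity.TimeBoundsProofs
import Literature.Computability.Complexity.Space
import Mathlib.Tactic.DeriveFintype
import HarnessLib

/-!
# The streaming loop machine, I: definitions

Route `UniformStream`, crux `UniformStreamLB` (stmt-PneNP-16045), line `birth`, stub `stub_streamLoop`
(`--supports stmt-PneNP-16045`; proved in `UniformStreamUniformStreamLBStubStreamLoop.lean`): a
uniform one-pass streaming algorithm whose rounds (`00·cnt n ↦ cnt (n+1)`, `01·cnt N ↦ init N`,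
`10·b·st ↦ upd N st b`, `11·st ↦ [acc N st]`) are computed by ONE round machine
`M : TM2ComputableAux Bool Bool` within `B N` steps decides a language of the simultaneous
time–space class `DTISP (N · B N + B N) (B N)` (`Space.lean`; Arora–Barak 2009, Def. 4.1, 5.10).

This file holds ALL the definitions of the proof (the later parts are theorems only): the deciding
**streaming loop machine** `StreamLoop.streamTM M` / `StreamLoop.streamSM M` (a
`SpaceMachine Bool Bool`), after the loop machine of `SpaceLoop.lean` (reusing its stack bookkeeping
`SpaceLoop.Aux`, `LoopΓ`, `mkStk`): stacks `M.K ⊕ Aux` (`IN` = input stack, `LEFT` = left input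
stack, `TMP`; output stack `inl M.k₁`), labels `M.Λ ⊕ Lbl`, states `M.σ × Option Bool × Ph` (a symbol
register and a PHASE register); control flow in `lblStmt`; the statements of `M` act on the first
state component (`trS`). Also: configurations `conf`/`embM`, the work space `wsp` (stacks of `M`,
`TMP`, `OUT` — the read-only input `LEFT`/`IN` is not charged, Arora–Barak 2009, Def. 4.1) and the
work-space bound `Wb = B N + 3 + #stacks · D · B N`.

## References

* S. Arora, B. Barak, *Computational Complexity: A Modern Approach*, CUP 2009, Def. 4.1 (space
  bounded computation, read-only input), §4.1 (space is reused), Thm. 4.2, Def. 5.10 (TISP).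
  [AroraBarak2009]
* Mathlib, `Mathlib/Computability/TuringMachine/Computable.lean` (`FinTM2`, `initList`, `haltList`).
-/

set_option linter.dupNamespace false

noncomputable section

namespace Summit.PneNP.PneNP.Theorems.UniformStreamLB.Birth

namespace StreamLoop

open Literature.Computability.Complexity Literature.Computability.Complexity.TM2Comp
  Literature.Computability.Complexity.SpaceLoop Turing StateTransition Function

/-! ### Control labels and phases -/

/-- The control labels of the streaming loop machine (besides the labels of the round machine):
`cnt` (one counting round per input symbol, moving the head right), `feed` (pour `TMP` onto the
input stack of the round machine and push the tag word of the current phase), `ret` (reached when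
the round machine halts: halt after the accepting round, otherwise `mv`), `mv` (pour the output of
the round machine onto `TMP`), `rew` (rewind the read-only head), `strm` (one streaming round per
input symbol). [folklore] -/
inductive Lbl
  | cnt | feed | ret | mv | rew | strm
  deriving DecidableEq, Fintype

/-- The phase register: counting rounds, the initialising round, a streaming round carrying the
input bit `b` in transit, the accepting round. [folklore] -/
inductive Ph
  | count | init | stream (b : Bool) | accept
  deriving DecidableEq, Fintype

namespace Ph

/-- First tag symbol of the word fed to the round machine in a phase. [folklore] -/
def tagHi : Ph → Bool
  | count | init => false
  | stream _ | accept => true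

/-- Second tag symbol of the word fed to the round machine in a phase. [folklore] -/
def tagLo : Ph → Bool
  | count | stream _ => false
  | init | accept => true

/-- The input bit in transit (streaming rounds only). [folklore] -/
def bit : Ph → Option Bool
  | stream b => some b
  | count | init | accept => none

/-- The tag word pushed on top of the payload: `00`, `01`, `10b`, `11`. [folklore] -/
def tags (p : Ph) : List Bool := p.tagHi :: p.tagLo :: p.bit.toList

/-- Is this the accepting round? [folklore] -/
def isAcc : Ph → Bool
  | accept => true
  | count | init | stream _ => false

/-- The control label continuing after the output of a round has been poured onto `TMP`.
[folklore] -/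
def next : Ph → Lbl
  | count => Lbl.cnt
  | init | stream _ | accept => Lbl.strm

/-- Tag word of a counting round. [folklore] -/
@[simp] theorem tags_count : count.tags = [false, false] := rfl
/-- Tag word of the initialising round. [folklore] -/
@[simp] theorem tags_init : init.tags = [false, true] := rfl
/-- Tag word of a streaming round. [folklore] -/
@[simp] theorem tags_stream (b : Bool) : (stream b).tags = [true, false, b] := rfl
/-- Tag word of the accepting round. [folklore] -/
@[simp] theorem tags_accept : accept.tags = [true, true] := rfl
/-- Continuation after a counting round. [folklore] -/
@[simp] theorem next_count : count.next = Lbl.cnt := rfl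
/-- Continuation after the initialising round. [folklore] -/
@[simp] theorem next_init : init.next = Lbl.strm := rfl
/-- Continuation after a streaming round. [folklore] -/
@[simp] theorem next_stream (b : Bool) : (stream b).next = Lbl.strm := rfl

end Ph

/-! ### The machine: states, translated statements, control statements -/

section Machine

variable {K : Type} {G : K → Type} {Λ σ : Type}

/-- Internal states of the streaming loop machine: a state of the round machine, a register for
one symbol in transit (`none` between control steps) and the phase register. [folklore] -/
abbrev Sta (σ : Type) : Type := σ × Option Bool × Ph

/-- Reset the symbol register, keep the phase. [folklore] -/
def keep : Sta σ → Sta σ := fun v => (v.1, none, v.2.2)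

/-- Reset the symbol register and set the phase. [folklore] -/
def setPh (p : Ph) : Sta σ → Sta σ := fun v => (v.1, none, p)

/-- Translation of the statements of the round machine: act on the `inl` stacks and the first
state component; `halt` becomes a jump to the control label `ret`. [folklore] -/
def trS : TM2.Stmt G Λ σ → TM2.Stmt (LoopΓ G) (Λ ⊕ Lbl) (Sta σ)
  | TM2.Stmt.push k f q => TM2.Stmt.push (Sum.inl k) (fun s => f s.1) (trS q)
  | TM2.Stmt.peek k f q => TM2.Stmt.peek (Sum.inl k) (fun s x => (f s.1 x, s.2)) (trS q)
  | TM2.Stmt.pop k f q => TM2.Stmt.pop (Sum.inl k) (fun s x => (f s.1 x, s.2)) (trS q)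
  | TM2.Stmt.load f q => TM2.Stmt.load (fun s => (f s.1, s.2)) (trS q)
  | TM2.Stmt.branch f q₁ q₂ => TM2.Stmt.branch (fun s => f s.1) (trS q₁) (trS q₂)
  | TM2.Stmt.goto l => TM2.Stmt.goto fun s => Sum.inl (l s.1)
  | TM2.Stmt.halt => TM2.Stmt.goto fun _ => Sum.inr Lbl.ret

/-- Configuration of the streaming loop machine while the round machine runs, in phase `p`, with
remaining input `i` on `IN` and scanned input `lf` on `LEFT` (`TMP`, `OUT` empty); the halting
label is sent to `ret`. [folklore] -/
def embM (c : TM2.Cfg G Λ σ) (p : Ph) (i lf : List Bool) : TM2.Cfg (LoopΓ G) (Λ ⊕ Lbl) (Sta σ) :=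
  ⟨some (c.l.elim (Sum.inr Lbl.ret) Sum.inl), (c.var, none, p), mkStk c.stk i lf [] []⟩

variable (k₀ k₁ : K) (eIn : G k₀ ≃ Bool) (eOut : G k₁ ≃ Bool) (main : Λ)

/-- The common tail of `feed`: push the two tag symbols of the phase (second, then first, so that
the first is on top), reset the register and start the round machine. [folklore] -/
def feedFin : TM2.Stmt (LoopΓ G) (Λ ⊕ Lbl) (Sta σ) :=
  TM2.Stmt.push (Sum.inl k₀) (fun v => eIn.symm v.2.2.tagLo) <|
    TM2.Stmt.push (Sum.inl k₀) (fun v => eIn.symm v.2.2.tagHi) <|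
      TM2.Stmt.load keep <| TM2.Stmt.goto fun _ => Sum.inl main

/-- The control statements of the streaming loop machine.
* `cnt`: pop one input symbol from `IN`; if there is none go to `rew`; otherwise push it on `LEFT`
  and `feed` (a counting round: the counter word sits, reversed, on `TMP`);
* `feed`: pour `TMP` onto the input stack `k₀` of the round machine (this second reversal restores
  the order); when `TMP` is empty push the bit in transit (streaming rounds) and the two tag
  symbols of the phase, and jump to the main label of the round machine;
* `ret` (the translated `halt` of the round machine): in the accepting round `halt` (the verdict is
  on `k₁`, the output stack of the space machine); otherwise `mv`;
* `mv`: pour the output stack `k₁` of the round machine onto `TMP`, then continue with `cnt`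
  (counting phase) or `strm`;
* `rew`: pour `LEFT` back onto `IN`; when done, set the phase `init` and `feed`;
* `strm`: pop one input bit from `IN`; if there is none set the phase `accept` and `feed`; otherwise
  push it on `LEFT`, record it in the phase `stream b` and `feed`.
[cite: AroraBarak2009, Def. 4.1 and §4.1 (read-only input; space is reused across rounds)] -/
def lblStmt : Lbl → TM2.Stmt (LoopΓ G) (Λ ⊕ Lbl) (Sta σ)
  | Lbl.cnt =>
      TM2.Stmt.pop (Sum.inr Aux.IN) (fun v a => (v.1, a, v.2.2)) <|
        TM2.Stmt.branch (fun v => v.2.1.isNone)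
          (TM2.Stmt.load keep <| TM2.Stmt.goto fun _ => Sum.inr Lbl.rew)
          (TM2.Stmt.push (Sum.inr Aux.LEFT) (fun v => v.2.1.getD false) <|
            TM2.Stmt.load keep <| TM2.Stmt.goto fun _ => Sum.inr Lbl.feed)
  | Lbl.feed =>
      TM2.Stmt.pop (Sum.inr Aux.TMP) (fun v a => (v.1, a, v.2.2)) <|
        TM2.Stmt.branch (fun v => v.2.1.isNone)
          (TM2.Stmt.branch (fun v => v.2.2.bit.isSome)
            (TM2.Stmt.push (Sum.inl k₀) (fun v => eIn.symm (v.2.2.bit.getD false))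
              (feedFin k₀ eIn main))
            (feedFin k₀ eIn main))
          (TM2.Stmt.push (Sum.inl k₀) (fun v => eIn.symm (v.2.1.getD false)) <|
            TM2.Stmt.load keep <| TM2.Stmt.goto fun _ => Sum.inr Lbl.feed)
  | Lbl.ret =>
      TM2.Stmt.branch (fun v => v.2.2.isAcc) TM2.Stmt.halt (TM2.Stmt.goto fun _ => Sum.inr Lbl.mv)
  | Lbl.mv =>
      TM2.Stmt.pop (Sum.inl k₁) (fun v a => (v.1, a.map eOut, v.2.2)) <|
        TM2.Stmt.branch (fun v => v.2.1.isNone)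
          (TM2.Stmt.load keep <| TM2.Stmt.goto fun v => Sum.inr v.2.2.next)
          (TM2.Stmt.push (Sum.inr Aux.TMP) (fun v => v.2.1.getD false) <|
            TM2.Stmt.load keep <| TM2.Stmt.goto fun _ => Sum.inr Lbl.mv)
  | Lbl.rew =>
      TM2.Stmt.pop (Sum.inr Aux.LEFT) (fun v a => (v.1, a, v.2.2)) <|
        TM2.Stmt.branch (fun v => v.2.1.isNone)
          (TM2.Stmt.load (setPh Ph.init) <| TM2.Stmt.goto fun _ => Sum.inr Lbl.feed)
          (TM2.Stmt.push (Sum.inr Aux.IN) (fun v => v.2.1.getD false) <|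
            TM2.Stmt.load keep <| TM2.Stmt.goto fun _ => Sum.inr Lbl.rew)
  | Lbl.strm =>
      TM2.Stmt.pop (Sum.inr Aux.IN) (fun v a => (v.1, a, v.2.2)) <|
        TM2.Stmt.branch (fun v => v.2.1.isNone)
          (TM2.Stmt.load (setPh Ph.accept) <| TM2.Stmt.goto fun _ => Sum.inr Lbl.feed)
          (TM2.Stmt.push (Sum.inr Aux.LEFT) (fun v => v.2.1.getD false) <|
            TM2.Stmt.load (fun v => (v.1, none, Ph.stream (v.2.1.getD false))) <|
              TM2.Stmt.goto fun _ => Sum.inr Lbl.feed)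

end Machine

/-! ### Bundling: the streaming loop machine as a `FinTM2` and as a space machine -/

section Bundled

variable (M : FinTM2)

/-- The (unbundled) type of configurations of the streaming loop machine. [folklore] -/
abbrev Conf : Type := TM2.Cfg (LoopΓ M.Γ) (M.Λ ⊕ Lbl) (Sta M.σ)

/-- Configurations with reset symbol register, from the label, the `M`-state, the phase, the
stacks of `M` and the auxiliary stacks `IN`, `LEFT`, `TMP` (`OUT` is never used). [folklore] -/
def conf (l : Option (M.Λ ⊕ Lbl)) (v : M.σ) (p : Ph) (S : ∀ k, List (M.Γ k)) (i lf t : List Bool) :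
    Conf M :=
  ⟨l, (v, none, p), mkStk S i lf t []⟩

variable (eIn : M.Γ M.k₀ ≃ Bool) (eOut : M.Γ M.k₁ ≃ Bool)

/-- **The streaming loop machine** of a bundled round machine `M` with Boolean input and output
alphabets: stacks `M.K ⊕ Aux` (input stack `IN`, output stack `inl M.k₁`), labels `M.Λ ⊕ Lbl`
(main label `cnt`), states `M.σ × Option Bool × Ph`.
[cite: AroraBarak2009, Def. 4.1 and §4.1 (space-bounded computation with read-only input)] -/
def streamTM : FinTM2 :=
  letI := M.kFin; letI := M.ΛFin; letI := M.σFin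
  { K := M.K ⊕ Aux
    k₀ := Sum.inr Aux.IN
    k₁ := Sum.inl M.k₁
    Γ := LoopΓ M.Γ
    Λ := M.Λ ⊕ Lbl
    main := Sum.inr Lbl.cnt
    σ := Sta M.σ
    initialState := (M.initialState, none, Ph.count)
    Γk₀Fin := (inferInstance : Fintype Bool)
    m := fun l => match l with
      | Sum.inl l => trS (M.m l)
      | Sum.inr c => lblStmt M.k₀ M.k₁ eIn eOut M.main c }

/-- **The streaming loop machine as a space machine**: read-only input on `LEFT`/`IN`, output on
the output stack of the round machine. [cite: AroraBarak2009, Def. 4.1] -/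
def streamSM : SpaceMachine Bool Bool where
  tm := streamTM M eIn eOut
  inputAlphabet := Equiv.refl Bool
  outputAlphabet := eOut
  kL := Sum.inr Aux.LEFT
  kL_ne_k₀ := by simp [streamTM]
  kL_ne_k₁ := by simp [streamTM]
  leftAlphabet := Equiv.refl Bool

/-- A step at a control label, unbundled. [folklore] -/
theorem st_inr (c : Lbl) (var : Sta M.σ) (stk : ∀ j, List (LoopΓ M.Γ j)) :
    (streamTM M eIn eOut).step (⟨some (Sum.inr c), var, stk⟩ : Conf M) =
      some (TM2.stepAux (lblStmt M.k₀ M.k₁ eIn eOut M.main c) var stk) :=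
  rfl

/-- A step at a label of the round machine, unbundled. [folklore] -/
theorem st_inl (l : M.Λ) (var : Sta M.σ) (stk : ∀ j, List (LoopΓ M.Γ j)) :
    (streamTM M eIn eOut).step (⟨some (Sum.inl l), var, stk⟩ : Conf M) =
      some (TM2.stepAux (trS (M.m l)) var stk) :=
  rfl

/-- The halted machine does not move. [folklore] -/
theorem st_none (var : Sta M.σ) (stk : ∀ j, List (LoopΓ M.Γ j)) :
    (streamTM M eIn eOut).step (⟨none, var, stk⟩ : Conf M) = none :=
  rfl

/-! ### Work space -/

section Space

/-- The work space of a configuration: the stacks of `M` and the auxiliary stacks `TMP`, `OUT`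
(the input stacks `IN`, `LEFT` are not charged; cf. `workSpace_eq_wsp`).
[cite: AroraBarak2009, Def. 4.1 (only work tapes are charged)] -/
def wsp (c : Conf M) : ℕ :=
  stkLen M (fun k => c.stk (Sum.inl k)) + (c.stk (Sum.inr Aux.TMP)).length +
    (c.stk (Sum.inr Aux.OUT)).length

/-- Work space of an explicit configuration. [folklore] -/
@[simp] theorem wsp_mk (l : Option (M.Λ ⊕ Lbl)) (var : Sta M.σ) (S : ∀ k, List (M.Γ k))
    (i lf t o : List Bool) :
    wsp M ⟨l, var, mkStk S i lf t o⟩ = stkLen M S + t.length + o.length := rfl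

/-- Work space of a `conf`. [folklore] -/
@[simp] theorem wsp_conf (l : Option (M.Λ ⊕ Lbl)) (v : M.σ) (p : Ph) (S : ∀ k, List (M.Γ k))
    (i lf t : List Bool) :
    wsp M (conf M l v p S i lf t) = stkLen M S + t.length := rfl

/-- Work space of an embedded configuration of `M`. [folklore] -/
@[simp] theorem wsp_embM (c : M.Cfg) (p : Ph) (i lf : List Bool) :
    wsp M (embM c p i lf) = stkLen M c.stk := by
  simp [embM, wsp]

end Space

end Bundled

/-! ### The work-space bound -/

section WorkBound

variable (Mx : TM2ComputableAux Bool Bool)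

/-- The work-space bound: `B N + 3` symbols of payload plus the growth of a `B N`-step run of the
round machine. [folklore] -/
def Wb (B : ℕ → ℕ) (N : ℕ) : ℕ := B N + 3 + nStk Mx.tm * machinePushBound Mx.tm * B N

/-- The payload part of the work-space bound. [folklore] -/
theorem le_Wb (B : ℕ → ℕ) (N : ℕ) : B N + 3 ≤ Wb Mx B N := Nat.le_add_right _ _

/-- The work-space bound is `O(B N)`. [folklore] -/
theorem Wb_le (B : ℕ → ℕ) (N : ℕ) :
    Wb Mx B N ≤ (16 + nStk Mx.tm * machinePushBound Mx.tm) * B N +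
      (16 + nStk Mx.tm * machinePushBound Mx.tm) := by
  unfold Wb
  have : (16 + nStk Mx.tm * machinePushBound Mx.tm) * B N =
      16 * B N + nStk Mx.tm * machinePushBound Mx.tm * B N := by ring
  omega

end WorkBound

end StreamLoop

/-- **Registered sub-goal `stub_streamLoop_part1` (part 1 of the proof of `stub_streamLoop`): the
work-space bound `StreamLoop.Wb` of the streaming loop machine is `O(B N)`, with the constant
`16 + #stacks · D` that serves both bounds of `DTISP` in `stub_streamLoop`.** [folklore] -/
theorem stub_streamLoop_part1 :
    ∀ (M : Turing.TM2ComputableAux Bool Bool) (B : ℕ → ℕ) (N : ℕ),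
      StreamLoop.Wb M B N ≤
        (16 + Literature.Computability.Complexity.SpaceLoop.nStk M.tm *
            Literature.Computability.Complexity.TM2Comp.machinePushBound M.tm) * B N +
          (16 + Literature.Computability.Complexity.SpaceLoop.nStk M.tm *
            Literature.Computability.Complexity.TM2Comp.machinePushBound M.tm) :=
  StreamLoop.Wb_le

end Summit.PneNP.PneNP.Theorems.UniformStreamLB.Birth
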